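import Summits.NavierStokesRegularity.NavierStokesRegularity.Theorems.CertifiedBlowupCertifiedBlowupAxisymBlowupSwirlPersists
import Literature.Analysis.FluidPDE.SelfSimilar
import HarnessLib

/-!
# No witness of the crux `CertifiedBlowupAxisymBlowup` is backward (discretely) self-similar
# about a point of the axis

Theorems file landed `--supports stmt-NavierStokesRegularity-0727`, line `compact-amplification`
(continuation lead c4; registered stub `not_axisDSS_of_isMaximalSmoothSolution`). A witness of the
crux is a viscosity `ν > 0`, a time `T > 0` and a maximal smooth solution `(u, p)` of the unforced
Navier–Stokes system of lifespan `T`, Leray–Hopf on `[0, T]` from its rapidly decaying axisymmetric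
datum `u 0`. The exact and the discretely self-similar blow-up scenarios about a point `x₀` of the
symmetry axis are impossible for such a witness, with NO integrability or profile-equation
assumption:

* `not_axisDSS_of_isMaximalSmoothSolution`: for no factor `c ∈ (0, 1)` and no final window
  `(t₁, T)` is `u` backward discretely self-similar about `(T, x₀)`, i.e.
  `u t x = c • u (T − c² (T − t)) (x₀ + c • (x − x₀))` on `(t₁, T) × ℝ³` (Chae–Wolf 2017,
  Def. 1.1, the `λ`-DSS relation `u (t, x) = λ u (λ² t, λ x)` in the blow-up variables centred at
  `(T, x₀)`). Reason: for `x₀` on the axis the DSS relation transports the swirl `Γ = r u_θ =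
  x₀ u₁ − x₁ u₀` (KNSS 2009, (1.8)) of the slice at time `t` onto the swirl of the slice at the
  LATER time `t' = T − c² (T − t) ∈ (t, T)`: `Γ (t, x) = Γ (t', x₀ + c (x − x₀))`, so
  `sup |Γ (t', ·)| ≥ sup |Γ (t, ·)|`; but along every witness the swirl supremum is STRICTLY
  decreasing on `[0, T)` (`swirlSup_strictAnti_of_isMaximalSmoothSolution`, the threshold structure
  (T1) of route `SwirlThreshold`, unconditional for witnesses).
* `not_axisSelfSimilar_of_isMaximalSmoothSolution`: in particular `u` is not given on any final
  window by Leray's backward ansatz `lerayBackward a T U t (x − x₀)` (Leray 1934, (3.11);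
  Nečas–Růžička–Šverák 1996, (1.3)) about an axis point, for ANY profile `U` and rate `a > 0` —
  Leray's ansatz is `c`-DSS for every `c ∈ (0, 1)` (take `c = 1/2`).

No new definitions, no named-fact hypotheses, no `sorry`.

## References

* D. Chae, J. Wolf, *Removing discretely self-similar singularities for the 3D Navier–Stokes
  equations*, Comm. PDE 42 (2017), Def. 1.1. [ChaeWolf2017RemovingDSS]
* G. Koch, N. Nadirashvili, G. Seregin, V. Šverák, *Liouville theorems for the Navier–Stokes
  equations and applications*, Acta Math. 203 (2009), (1.8). [KNSS2009]
* J. Leray, *Sur le mouvement d'un liquide visqueux emplissant l'espace*, Acta Math. 63 (1934),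
  (3.11). [Leray1934]
* J. Nečas, M. Růžička, V. Šverák, *On Leray's self-similar solutions of the Navier–Stokes
  equations*, Acta Math. 176 (1996), (1.3).
-/

-- the summit and its single problem share the name (D-0017 nested layout)
set_option linter.dupNamespace false

noncomputable section

open MeasureTheory Set Function Filter Topology Metric
open scoped ENNReal NNReal

namespace Summit.NavierStokesRegularity.NavierStokesRegularity.Theorems.CertifiedBlowupAxisymBlowup.CompactAmplification

open Literature.Analysis Literature.Analysis.FluidPDE

/-- **The DSS relation about an axis point transports the swirl.** If `x₀` lies on the axis
(`r (x₀) = 0`, i.e. `x₀ 0 = x₀ 1 = 0`) and `v x = c • w (x₀ + c • (x − x₀))` for all `x`, then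
`Γ_v (x) = Γ_w (x₀ + c • (x − x₀))`, where `Γ_u (x) = x₀ u₁ (x) − x₁ u₀ (x)` is the swirl
(KNSS 2009, (1.8)): both horizontal coordinates and both horizontal velocity components pick up
the same factor `c`. [folklore] -/
private theorem swirl_eq_of_dss {c : ℝ} {x₀ : EuclideanSpace ℝ (Fin 3)} (hx₀ : cylRadius x₀ = 0)
    {v w : EuclideanSpace ℝ (Fin 3) → EuclideanSpace ℝ (Fin 3)}
    (h : ∀ x, v x = c • w (x₀ + c • (x - x₀))) (x : EuclideanSpace ℝ (Fin 3)) :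
    swirl v x = swirl w (x₀ + c • (x - x₀)) := by
  obtain ⟨h0, h1⟩ := (cylRadius_eq_zero_iff x₀).1 hx₀
  simp only [swirl, h x, PiLp.smul_apply, PiLp.add_apply, PiLp.sub_apply, smul_eq_mul, h0, h1]
  ring

/-- **No witness of the crux is backward discretely self-similar about a point of the axis**
(registered stub of stmt-NavierStokesRegularity-0727). Let `(u, p)` be a maximal smooth solution
of viscosity `ν > 0` and finite lifespan `T > 0`, Leray–Hopf on `[0, T]` from its rapidly decaying
axisymmetric datum `u 0`, let `x₀` lie on the axis, `c ∈ (0, 1)` and `0 ≤ t₁ < T`. Then the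
`c`-DSS relation about `(T, x₀)` (Chae–Wolf 2017, Def. 1.1, in the variables centred at the
blow-up point), `u t x = c • u (T − c² (T − t)) (x₀ + c • (x − x₀))` for all `t ∈ (t₁, T)` and all
`x`, FAILS. Proof: at `t = (t₁ + T)/2` the relation transports the swirl of `u t` onto the swirl of
`u t'`, `t < t' = T − c² (T − t) < T` (`swirl_eq_of_dss`), contradicting the strict decrease of
the swirl supremum along the witness (`swirlSup_strictAnti_of_isMaximalSmoothSolution`).
[cite: ChaeWolf2017RemovingDSS, Def. 1.1] -/
theorem not_axisDSS_of_isMaximalSmoothSolution : ∀ {ν T : ℝ} {u : ℝ → EuclideanSpace ℝ (Fin 3) → EuclideanSpace ℝ (Fin 3)} {p : ℝ → EuclideanSpace ℝ (Fin 3) → ℝ}, 0 < ν → 0 < T → IsMaximalSmoothSolution ν 0 u p T → IsLerayHopfOn T ν 0 (u 0) u → HasRapidSpatialDecay (u 0) → IsAxisymmetric (u 0) → ∀ x₀ : EuclideanSpace ℝ (Fin 3), cylRadius x₀ = 0 → ∀ c : ℝ, 0 < c → c < 1 → ∀ t₁ : ℝ, 0 ≤ t₁ → t₁ < T → ¬ ∀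 t ∈ Set.Ioo t₁ T, ∀ x, u t x = c • u (T - c ^ 2 * (T - t)) (x₀ + c • (x - x₀)) := by
  intro ν T u p hν hT hmax hLH hdec haxi x₀ hx₀ c hc hc1 t₁ ht₁ ht₁T hDSS
  -- a time `t ∈ (t₁, T)`, e.g. the midpoint, and its DSS image `t' = T - c² (T - t) ∈ (t, T)`
  obtain ⟨t, ht₁t, htT⟩ : ∃ t, t₁ < t ∧ t < T := ⟨(t₁ + T) / 2, by linarith, by linarith⟩
  have ht0 : 0 ≤ t := ht₁.trans ht₁t.le
  have hc2 : c ^ 2 < 1 := by nlinarith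
  have hrel := hDSS t ⟨ht₁t, htT⟩
  set t' : ℝ := T - c ^ 2 * (T - t) with ht'
  have htt' : t < t' := by
    rw [ht']
    nlinarith [mul_pos (sub_pos.2 hc2) (sub_pos.2 htT)]
  have ht'T : t' < T := by
    rw [ht']
    nlinarith [mul_pos (pow_pos hc 2) (sub_pos.2 htT)]
  -- the swirl of `u t` is the transported swirl of `u t'` …
  have key : ∀ x, swirl (u t) x = swirl (u t') (x₀ + c • (x - x₀)) := swirl_eq_of_dss hx₀ hrel
  -- … whose supremum is strictly smaller: contradiction at the maximiser `y` of `|swirl (u t)|`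
  obtain ⟨y, hy⟩ :=
    swirlSup_strictAnti_of_isMaximalSmoothSolution hν hT hmax hLH hdec haxi t t' ht0 htt' ht'T
  have hlt := hy (x₀ + c • (y - x₀))
  rw [← key y] at hlt
  exact lt_irrefl _ hlt

/-- **No witness of the crux is given by Leray's backward self-similar ansatz about a point of
the axis** (corollary of `not_axisDSS_of_isMaximalSmoothSolution`). For a maximal smooth solution
`(u, p)` of viscosity `ν > 0` and lifespan `T > 0`, Leray–Hopf on `[0, T]` from its rapidly
decaying axisymmetric datum, `x₀` on the axis, ANY rate `a > 0` and ANY profile `U` (no profile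
equation, no integrability) and `0 ≤ t₁ < T`, the representation
`u t x = lerayBackward a T U t (x − x₀) = (2a(T−t))^{-1/2} U ((2a(T−t))^{-1/2} (x − x₀))`
(Leray 1934, (3.11); Nečas–Růžička–Šverák 1996, (1.3)) on `(t₁, T) × ℝ³` FAILS: Leray's ansatz
is `1/2`-DSS about `(T, x₀)`, since `√(2a (T − t)/4) = √(2a (T − t))/2`.
[cite: ChaeWolf2017RemovingDSS, Def. 1.1] -/
theorem not_axisSelfSimilar_of_isMaximalSmoothSolution : ∀ {ν T : ℝ} {u : ℝ → EuclideanSpace ℝ (Fin 3) → EuclideanSpace ℝ (Fin 3)} {p : ℝ → EuclideanSpace ℝ (Fin 3) → ℝ}, 0 < ν → 0 < T → IsMaximalSmoothSolution ν 0 u p T → IsLerayHopfOn T ν 0 (u 0) u → HasRapidSpatialDecay (u 0) → IsAxisymmetric (u 0) → ∀ x₀ : EuclideanSpace ℝ (Fin 3), cylRadius x₀ = 0 → ∀ a : ℝ, 0 < a → ∀ U : EuclideanSpace ℝ (Fin 3) → EuclideanSpace ℝ (Fin 3), ∀ t₁ : ℝ, 0 ≤ t₁ → t₁ < T → ¬ ∀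 t ∈ Set.Ioo t₁ T, ∀ x, u t x = lerayBackward a T U t (x - x₀) := by
  intro ν T u p hν hT hmax hLH hdec haxi x₀ hx₀ a ha U t₁ ht₁ ht₁T hSS
  refine not_axisDSS_of_isMaximalSmoothSolution hν hT hmax hLH hdec haxi x₀ hx₀ (1 / 2)
    one_half_pos one_half_lt_one t₁ ht₁ ht₁T fun t ht x => ?_
  -- the `1/2`-DSS image `t' = T - (T - t)/4` of `t ∈ (t₁, T)` lies in `(t₁, T)` as well
  have hTt : 0 < T - t := sub_pos.2 ht.2
  have ht' : T - (1 / 2) ^ 2 * (T - t) ∈ Set.Ioo t₁ T := by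
    constructor <;> nlinarith [ht.1, ht.2]
  rw [hSS t ht x, hSS _ ht', add_sub_cancel_left]
  simp only [lerayBackward_apply]
  -- `√(2a (T − t')) = √(2a (T − t)) / 2`
  have h2a : 0 ≤ 2 * a * (T - t) := (mul_pos (mul_pos two_pos ha) hTt).le
  set σ : ℝ := Real.sqrt (2 * a * (T - t)) with hσ
  have hσ0 : 0 ≤ σ := by
    rw [hσ]
    exact Real.sqrt_nonneg _
  have hroot : Real.sqrt (2 * a * (T - (T - (1 / 2) ^ 2 * (T - t)))) = σ / 2 := by
    rw [show 2 * a * (T - (T - (1 / 2) ^ 2 * (T - t))) = (σ / 2) ^ 2 by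
      rw [div_pow σ, hσ, Real.sq_sqrt h2a]; ring]
    exact Real.sqrt_sq (div_nonneg hσ0 two_pos.le)
  have e : (σ / 2)⁻¹ = 2 * σ⁻¹ := by
    rw [inv_div, div_eq_mul_inv]
  have e1 : (1 / 2 : ℝ) * (2 * σ⁻¹) = σ⁻¹ := by ring
  have e2 : 2 * σ⁻¹ * (1 / 2 : ℝ) = σ⁻¹ := by ring
  rw [hroot, e, smul_smul, smul_smul, e1, e2]

end Summit.NavierStokesRegularity.NavierStokesRegularity.Theorems.CertifiedBlowupAxisymBlowup.CompactAmplification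

end
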